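import Summits.CriticalPhenomena.PercolationContinuityZ3.Theses.PercBudgetLadder
import Summits.CriticalPhenomena.PercolationContinuityZ3.Theorems.PercBudgetLadderSufficesTarget

/-!
# Route `PercBudgetLadder`, item `Assembly` (stmt-CriticalPhenomena-5255)

`Assembly` says: `BudgetTightness → PinholeClosing → BlockingVanishesOfTheta → PercolationContinuityZ3`.

Proof (pure logic, Grimmett 1999 §11.7-style descent in the *budget* variable):

* **k-step budget descent.** `BudgetTightness` gives a budget `k`, an aspect ratio `l ≥ 2` and `c > 0`
  such that for infinitely many `n` the critical annulus `box 3 n → innerBoundary (box 3 (l n))` can be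
  blocked by closing at most `k` edges with probability `≥ c`.  `PinholeClosing` (uniform in `n ≥ 1`)
  trades budget `j + 1` at aspect `l'` for budget `j` at aspect `2 l'`, keeping an i.o. lower bound
  (we only ask for witnesses `n ≥ N + 1 ≥ 1`).  Induction on `k` reaches budget `0` at aspect `2^k l ≥ 2`.
* **Budget `0` is the blocked event.** `S.card ≤ 0` forces `S = ∅` and `ω \ ∅ = ω`, so the budget-`0`
  event is literally the event of `CritAnnulusBlockedIO`.
* **It suffices.** `sufficesTarget_proof` (item 5254, in the tree): the i.o. blocking lower bound at
  `p_c` together with `BlockingVanishesOfTheta` gives `θ(p_c) = 0`, i.e. `PercolationContinuityZ3`.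

The first two bullets are packaged as
`ladderReachesTarget_proof : LadderReachesTarget` (= `BudgetTightness → PinholeClosing → CritAnnulusBlockedIO`,
the support statement of item stmt-CriticalPhenomena-14173, proved here on the way).
-/

namespace Summit.CriticalPhenomena.PercolationContinuityZ3.Theorems

open Filter
open Summit.CriticalPhenomena.PercolationContinuityZ3.Theses.PercBudgetLadder

/-- **k-step budget descent at fixed budget level** (helper for `Assembly`, route `PercBudgetLadder`).
Under `PinholeClosing`, an infinitely-often lower bound `≥ c > 0` for the `P_{p_c}`-probability that the
annulus `box 3 n → innerBoundary (box 3 (l n))` can be blocked by closing at most `k` edges (aspect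
`l ≥ 2`) yields such a bound at budget `0` for some aspect `l' ≥ 2` and some `c' > 0` (in fact
`l' = 2^k l`).  Induction on `k`; each step applies `PinholeClosing` at the witnesses `n ≥ 1`. [folklore] -/
theorem percBudgetLadder_budget_descent (hPC : PinholeClosing) (k : ℕ) :
    ∀ (l : ℕ) (c : ℝ), 2 ≤ l → 0 < c →
      (∀ N : ℕ, ∃ n : ℕ, N ≤ n ∧ c ≤ (Literature.Probability.Percolation.bondPercolation
        (Literature.Probability.LatticeModels.zdGraph 3)
        (Literature.Probability.Percolation.criticalProbI 3)).real
        {ω | ∃ S : Finset (Sym2 (Literature.Probability.LatticeModels.Site 3)), S.card ≤ k ∧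
          ¬ ∃ x ∈ Literature.Probability.LatticeModels.box 3 n,
            ∃ y ∈ Literature.Probability.LatticeModels.innerBoundary
              (Literature.Probability.LatticeModels.zdGraph 3)
              (Literature.Probability.LatticeModels.box 3 (l * n)),
            (ω \ ↑S) ∈ Literature.Probability.Percolation.openConnIn
              ↑(Literature.Probability.LatticeModels.box 3 (l * n)) x y}) →
      ∃ (l' : ℕ) (c' : ℝ), 2 ≤ l' ∧ 0 < c' ∧
      (∀ N : ℕ, ∃ n : ℕ, N ≤ n ∧ c' ≤ (Literature.Probability.Percolation.bondPercolation
        (Literature.Probability.LatticeModels.zdGraph 3)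
        (Literature.Probability.Percolation.criticalProbI 3)).real
        {ω | ∃ S : Finset (Sym2 (Literature.Probability.LatticeModels.Site 3)), S.card ≤ 0 ∧
          ¬ ∃ x ∈ Literature.Probability.LatticeModels.box 3 n,
            ∃ y ∈ Literature.Probability.LatticeModels.innerBoundary
              (Literature.Probability.LatticeModels.zdGraph 3)
              (Literature.Probability.LatticeModels.box 3 (l' * n)),
            (ω \ ↑S) ∈ Literature.Probability.Percolation.openConnIn
              ↑(Literature.Probability.LatticeModels.box 3 (l' * n)) x y}) := by
  induction k with
  | zero =>
    intro l c hl hc h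
    exact ⟨l, c, hl, hc, h⟩
  | succ k ih =>
    intro l c hl hc h
    -- one pinhole closed at the cost of doubling the aspect ratio, uniformly in `n ≥ 1`
    obtain ⟨c', hc', hstep⟩ := hPC k l c hl hc
    refine ih (2 * l) c' (by omega) hc' ?_
    intro N
    obtain ⟨n, hn, hbound⟩ := h (N + 1)
    exact ⟨n, by omega, hstep n (by omega) hbound⟩

/-- **The two load-bearing cruxes reach the target** (helper for `Assembly`, route `PercBudgetLadder`;
verbatim the support statement `LadderReachesTarget`, item stmt-CriticalPhenomena-14173):
`BudgetTightness → PinholeClosing → CritAnnulusBlockedIO`.  From `BudgetTightness` get `(k, l, c)`;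
the `k`-step descent `percBudgetLadder_budget_descent` reaches budget `0` at some aspect `l' ≥ 2`;
budget `0` is literally the blocked event (`S.card ≤ 0` forces `S = ∅`, and `ω \ ∅ = ω`). [folklore] -/
theorem ladderReachesTarget_proof :
    Summit.CriticalPhenomena.PercolationContinuityZ3.Theses.PercBudgetLadder.LadderReachesTarget := by
  unfold Summit.CriticalPhenomena.PercolationContinuityZ3.Theses.PercBudgetLadder.LadderReachesTarget
    CritAnnulusBlockedIO
  intro hBT hPC
  obtain ⟨k, l, c, hl, hc, hio⟩ := hBT
  obtain ⟨l', c', hl', hc', hio'⟩ := percBudgetLadder_budget_descent hPC k l c hl hc hio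
  refine ⟨l', c', hl', hc', ?_⟩
  intro N
  obtain ⟨n, hn, hbound⟩ := hio' N
  refine ⟨n, hn, ?_⟩
  -- budget 0 is the blocked event
  have hset :
      {ω : Set (Sym2 (Literature.Probability.LatticeModels.Site 3)) |
        ∃ S : Finset (Sym2 (Literature.Probability.LatticeModels.Site 3)), S.card ≤ 0 ∧
          ¬ ∃ x ∈ Literature.Probability.LatticeModels.box 3 n,
            ∃ y ∈ Literature.Probability.LatticeModels.innerBoundary
              (Literature.Probability.LatticeModels.zdGraph 3)
              (Literature.Probability.LatticeModels.box 3 (l' * n)),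
            (ω \ ↑S) ∈ Literature.Probability.Percolation.openConnIn
              ↑(Literature.Probability.LatticeModels.box 3 (l' * n)) x y} =
      {ω | ¬ ∃ x ∈ Literature.Probability.LatticeModels.box 3 n,
            ∃ y ∈ Literature.Probability.LatticeModels.innerBoundary
              (Literature.Probability.LatticeModels.zdGraph 3)
              (Literature.Probability.LatticeModels.box 3 (l' * n)),
            ω ∈ Literature.Probability.Percolation.openConnIn
              ↑(Literature.Probability.LatticeModels.box 3 (l' * n)) x y} := by
    ext ω
    constructor
    · rintro ⟨S, hS, hnot⟩
      have hS0 : S = ∅ := Finset.card_eq_zero.mp (Nat.le_zero.mp hS)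
      subst hS0
      simpa using hnot
    · intro hnot
      exact ⟨∅, by simp, by simpa using hnot⟩
  rw [hset] at hbound
  exact hbound

/-- **Item `stmt-CriticalPhenomena-5255` (`PercBudgetLadder.Assembly`), proved.**
`BudgetTightness → PinholeClosing → BlockingVanishesOfTheta → PercolationContinuityZ3`:
the `k`-step budget descent (`ladderReachesTarget_proof`)
gives the i.o. blocked critical annuli `CritAnnulusBlockedIO`, and the zero–one-law contradiction at
`p = p_c` (`sufficesTarget_proof`, item 5254) turns it, with `BlockingVanishesOfTheta`, into
`θ_{ℤ³}(p_c) = 0`. [folklore] -/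
theorem percBudgetLadderAssembly_proof :
    Summit.CriticalPhenomena.PercolationContinuityZ3.Theses.PercBudgetLadder.Assembly := by
  unfold Summit.CriticalPhenomena.PercolationContinuityZ3.Theses.PercBudgetLadder.Assembly
  intro hBT hPC hBV
  have hL : LadderReachesTarget := ladderReachesTarget_proof
  unfold LadderReachesTarget CritAnnulusBlockedIO at hL
  have h : SufficesTarget := sufficesTarget_proof
  unfold SufficesTarget at h
  unfold BlockingVanishesOfTheta at hBV
  exact h (hL hBT hPC) hBV

end Summit.CriticalPhenomena.PercolationContinuityZ3.Theorems
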